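import Mathlib
import Summits.ResolutionOfSingularities.ResolutionOfSingularities.Theorems.WeightedInvariantLocalWeightedDropMonicDescentTailBookkeeping

/-!
# `WeightedInvariant.LocalWeightedDrop`, sub-stub N4″: the straightened labels of a β-neutral chain and the POINT-STEP LAW (T-5′ steps (s3)–(s4a))

Crux item stmt-ResolutionOfSingularities-8899 `LocalWeightedDrop` (route `ResolutionOfSingularities/WeightedInvariant`), door
`WeightedConstruction` stmt-ResolutionOfSingularities-0571.  [OURS · L1 W4.3, chain w43, lead prover; piece T-5′ of `N4PRIME-PLAN.md` (§9).  MODEL: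
Cossart–Jannsen–Saito LNM 2270 Thm 13.7 / Claim 13.8.]

Along a β-neutral Σ**-chain `A` (all steps neutral, see `…TailStabilise`), straighten every label by the LIMIT SHEAR of `…TailBookkeeping`:
`S m := shearLabel (hser m) (A m)`, `Â m := prep (S m)`.  ONE-STEP LAWS: at a point step `Â (m+1)` and `blowOneLabel (Â m)` are both well-prepared
re-centrings of `blowOneLabel (S m)` (shears add, commute with `blowOne` and with re-centrings), so they have the same `(ε, ζ)` (`epsL_zetaL_eq_of_wellPrepared`)
and `ζ` drops by `2 − ε ≥ 1`; at a curve step likewise with `divOneLabel`, `ζ` drops by `2`.  `ε ≤ 1` because `ε ≥ 2` at a point step would exhibit a graph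
curve (`HasGraphCurve`) — excluded by neutrality.  Hence `ζ(Â m) + m ≤ ζ(Â 0)`: no infinite chain.
THIS FILE: the definitions `Slab`, `Ahat`, their basic properties, the shape of a point step, and the point-step law `step_point`; the curve-step law and
the conclusion follow in `…MonicDescentNoChain`.
-/

set_option linter.dupNamespace false -- mandated namespace of this single-conjunct summit

noncomputable section

namespace Summit.ResolutionOfSingularities.ResolutionOfSingularities.Theorems

namespace MonicDescent

open MvPowerSeries Literature.RingTheory.TwoVariableSeries Literature.AlgebraicGeometry.Resolution

attribute [local instance] Classical.propDecidable

variable {k : Type} [Field k]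

/-! ## Small algebra -/

/-- The trivial shear. -/
theorem shear_zero_eq (A : MvPowerSeries (Fin 2) k) : shear 0 A = A := by
  rw [shear_eq]
  have : (![X 0, X 1 + X 0 * 0] : Fin 2 → MvPowerSeries (Fin 2) k) = X := by
    funext i; fin_cases i
    · rfl
    · show X 1 + X 0 * 0 = X 1
      rw [mul_zero, add_zero]
  rw [this, subst_self]
  rfl

/-- `recentre 0` is the identity. -/
theorem recentre_zero (A₀ A₁ : MvPowerSeries (Fin 2) k) : recentre 0 A₀ A₁ = (A₀, A₁) := by
  unfold recentre
  ext1 <;> simp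

/-- If a shear of a label by a series in `u₁` only is a double plane, so is the label (shears by such series are involutions in char 2). -/
theorem not_isDoublePlane_shear [CharP k 2] {h : MvPowerSeries (Fin 2) k} (hh : ∀ e : Fin 2 →₀ ℕ, e 1 ≠ 0 → coeff e h = 0)
    {A₀ A₁ : MvPowerSeries (Fin 2) k} (hA : ¬ IsDoublePlane A₀ A₁) : ¬ IsDoublePlane (shear h A₀) (shear h A₁) := by
  rintro ⟨r, h₁, h₀⟩
  apply hA
  have hinv : ∀ B : MvPowerSeries (Fin 2) k, shear h (shear h B) = B := by
    intro B
    rw [shear_shear_of_noY h h B hh, show h + h = 0 from by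
      have h2 : (2 : MvPowerSeries (Fin 2) k) = 0 := two_eq_zero
      linear_combination h * h2, shear_zero_eq]
  have h2 : (2 : MvPowerSeries (Fin 2) k) = 0 := two_eq_zero
  have hs : HasSubst ![(X 0 : MvPowerSeries (Fin 2) k), X 1 + X 0 * h] := hasSubst_of_constantCoeff_zero (constantCoeff_shearFamily h)
  refine ⟨shear h r, ?_, ?_⟩
  · rw [h2, zero_mul] at h₁ ⊢
    rw [← hinv A₁, h₁, shear_eq, ← coe_substAlgHom hs, map_zero]
  · rw [← hinv A₀, h₀, pow_two, pow_two, shear_mul]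

section Tail

variable [CharP k 2] [IsAlgClosed k]
  (hT1 : ∀ (k : Type) [Field k] [CharP k 2] [IsAlgClosed k] (A₀ A₁ : MvPowerSeries (Fin 2) k),
    IsPosition A₀ A₁ → ∃ ψ : MvPowerSeries (Fin 2) k, IsPrepRecentring A₀ A₁ ψ)
  (A : ℕ → Label k)
  (hA : ∀ m, WellPrepared (A m).1 (A m).2 ∧ IsPosition (A m).1 (A m).2 ∧ ¬ IsDoublePlane (A m).1 (A m).2 ∧
    IsNeutralStep (A m) (A (m + 1)))
  (hex : ∀ m, ∃ n, m ≤ n ∧ IsPointStep A n)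

/-- The STRAIGHTENED label `S m = (A m)(u₁, u₂ + u₁·hser m)`. -/
def Slab (m : ℕ) : Label k := shearLabel (hser A hex m) (A m)

/-- The PREPARED STRAIGHTENED label `Â m = prep (S m)`. -/
def Ahat (m : ℕ) : Label k := prep (Slab A hex m)

omit [CharP k 2] [IsAlgClosed k] in
include hA in
/-- `S m` is a position. -/
theorem isPosition_Slab (m : ℕ) : IsPosition (Slab A hex m).1 (Slab A hex m).2 :=
  isPosition_shearLabel _ (hA m).2.1

include hT1 hA in
/-- The preparing re-centring of `S m` is well-preparing (T-1′). -/
theorem prep_Slab (m : ℕ) :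
    IsPrepRecentring (Slab A hex m).1 (Slab A hex m).2 (prepPsi (Slab A hex m).1 (Slab A hex m).2) :=
  isPrepRecentring_prepPsi (hT1 k _ _ (isPosition_Slab A hA hex m))

include hT1 hA in
/-- `Â m` is a well-prepared position with non-empty Newton set, and a re-centring of `S m`. -/
theorem Ahat_spec (m : ℕ) :
    WellPrepared (Ahat A hex m).1 (Ahat A hex m).2 ∧ IsPosition (Ahat A hex m).1 (Ahat A hex m).2 ∧
    (newtonSet (Ahat A hex m).1 (Ahat A hex m).2).Nonempty ∧
    Ahat A hex m = recentre (prepPsi (Slab A hex m).1 (Slab A hex m).2) (Slab A hex m).1 (Slab A hex m).2 := by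
  obtain ⟨-, hpos, hWP, -⟩ := prep_Slab hT1 A hA hex m
  refine ⟨hWP, hpos, ?_, rfl⟩
  apply newtonSet_nonempty_of_not_isDoublePlane
  intro hpl
  have := isDoublePlane_of_recentre hpl
  exact not_isDoublePlane_shear (hser_noY A hex m) (hA m).2.2.1 this

/-! ### The point step -/

include hT1 hA in
/-- At a point step, `A (m+1) = blowOneLabel Q` with `Q` a position re-centring `shearLabel (C (param m)) (A m)` by some `ψ` of order `≥ 1`. -/
theorem pointStep_shape {m : ℕ} (hm : IsPointStep A m) :
    ∃ ψ : MvPowerSeries (Fin 2) k, constantCoeff ψ = 0 ∧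
      IsPosition (recentre ψ (shear (C (param A m)) (A m).1) (shear (C (param A m)) (A m).2)).1
        (recentre ψ (shear (C (param A m)) (A m).1) (shear (C (param A m)) (A m).2)).2 ∧
      A (m + 1) = blowOneLabel (recentre ψ (shear (C (param A m)) (A m).1) (shear (C (param A m)) (A m).2)) := by
  obtain ⟨h1, h2, h3, c, hc⟩ := pointStep_cases A hA hm
  by_cases hex' : ∃ c : k, c ≠ 0 ∧ A (m + 1) = blowOneLabel (prep (shearLabel (C c) (A m)))
  · have hparam : param A m = Classical.choose hex' := by
      unfold param; rw [dif_pos ⟨hm, hex'⟩]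
    obtain ⟨hcne, hAeq⟩ := Classical.choose_spec hex'
    rw [← hparam] at hAeq
    have hposS : IsPosition (shear (C (param A m)) (A m).1) (shear (C (param A m)) (A m).2) := isPosition_shearLabel _ (hA m).2.1
    obtain ⟨hψ0, hpos, -, -⟩ := isPrepRecentring_prepPsi (hT1 k _ _ hposS)
    exact ⟨_, hψ0, hpos, hAeq⟩
  · have hparam : param A m = 0 := by
      unfold param; rw [dif_neg (fun h => hex' h.2)]
    rcases hc with ⟨-, hAeq⟩ | ⟨hcne, hAeq⟩
    · refine ⟨0, map_zero _, ?_, ?_⟩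
      · rw [hparam, map_zero, recentre_zero, shear_zero_eq, shear_zero_eq]; exact (hA m).2.1
      · rw [hAeq, hparam, map_zero, recentre_zero, shear_zero_eq, shear_zero_eq]
    · exact absurd ⟨c, hcne, hAeq⟩ hex'

include hT1 hA in
/-- POINT-STEP LAW: `ε(Â (m+1)) = ε(Â m)` and `ζ(Â (m+1)) = ζ(Â m) + ε(Â m) − 2`. -/
theorem step_point {m : ℕ} (hm : IsPointStep A m) :
    epsL (newtonSet (Ahat A hex (m + 1)).1 (Ahat A hex (m + 1)).2) = epsL (newtonSet (Ahat A hex m).1 (Ahat A hex m).2) ∧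
    zetaL (newtonSet (Ahat A hex (m + 1)).1 (Ahat A hex (m + 1)).2) =
      zetaL (newtonSet (Ahat A hex m).1 (Ahat A hex m).2) + epsL (newtonSet (Ahat A hex m).1 (Ahat A hex m).2) - 2 := by
  obtain ⟨ψ, hψ0, hQpos, hAeq⟩ := pointStep_shape hT1 A hA hm
  set c := param A m with hc
  set h' := hser A hex (m + 1) with hh'
  have hh'noY := hser_noY A hex (m + 1)
  have hrel : hser A hex m = C c + X 0 * h' := hser_of_isPointStep A hex hm
  -- the label S m and its blow-up
  set S₀ := (Slab A hex m).1 with hS₀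
  set S₁ := (Slab A hex m).2 with hS₁
  have hSdef₀ : S₀ = shear (hser A hex m) (A m).1 := rfl
  have hSdef₁ : S₁ = shear (hser A hex m) (A m).2 := rfl
  -- (1) S (m+1) = blowOneLabel (recentre ψ' (S m)) with ψ' = shear (X0 h') ψ
  set ψ' := shear (X 0 * h') ψ with hψ'
  have hQ₀ : (recentre ψ (shear (C c) (A m).1) (shear (C c) (A m).2)).1 = shear (C c) (A m).1 + shear (C c) (A m).2 * ψ + ψ ^ 2 := rfl
  have hQ₁ : (recentre ψ (shear (C c) (A m).1) (shear (C c) (A m).2)).2 = shear (C c) (A m).2 := recentre_snd_eq _ _ _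
  have hord₀ : ∀ e : Fin 2 →₀ ℕ, coeff e (recentre ψ (shear (C c) (A m).1) (shear (C c) (A m).2)).1 ≠ 0 → 2 ≤ e 0 + e 1 :=
    le_sum_of_le_order (c := 2) (by exact_mod_cast hQpos.1.le)
  have hord₁ : ∀ e : Fin 2 →₀ ℕ, coeff e (recentre ψ (shear (C c) (A m).1) (shear (C c) (A m).2)).2 ≠ 0 → 1 ≤ e 0 + e 1 :=
    le_sum_of_le_order (c := 1) (by exact_mod_cast hQpos.2.le)
  have hSsucc₀ : (Slab A hex (m + 1)).1 = blowOne 2 (S₀ + S₁ * ψ' + ψ' ^ 2) := by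
    show shear h' (A (m + 1)).1 = _
    rw [hAeq]
    show shear h' (blowOne 2 (recentre ψ (shear (C c) (A m).1) (shear (C c) (A m).2)).1) = _
    rw [← blowOne_shear 2 h' _ hh'noY hord₀, hQ₀, shear_recentre, shear_X_mul_shear_C, shear_X_mul_shear_C, ← hrel]
    rfl
  have hSsucc₁ : (Slab A hex (m + 1)).2 = blowOne 1 S₁ := by
    show shear h' (A (m + 1)).2 = _
    rw [hAeq]
    show shear h' (blowOne 1 (recentre ψ (shear (C c) (A m).1) (shear (C c) (A m).2)).2) = _
    rw [← blowOne_shear 1 h' _ hh'noY hord₁, hQ₁, shear_X_mul_shear_C, ← hrel]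
    rfl
  -- orders for `blowOne_recentre`
  have hSpos := isPosition_Slab A hA hex m
  have hS₀ord : (2 : ℕ∞) ≤ S₀.order := hSpos.1.le
  have hS₁ord : (1 : ℕ∞) ≤ S₁.order := hSpos.2.le
  have hψ'ord : (1 : ℕ∞) ≤ ψ'.order := by
    rw [hψ', shear_eq]
    refine le_trans ?_ (FormalShear.order_le_order_subst' _ (constantCoeff_shearFamily _) ψ)
    exact MvPowerSeries.one_le_order_iff_constCoeff_eq_zero.mpr hψ0 |> fun h => by simpa using h
  -- T := blowOneLabel (S m); X := blowOneLabel (Â m) = recentre χ₀ T; Y := Â (m+1) = recentre χ₁ T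
  set T₀ := blowOne 2 S₀ with hT₀
  set T₁ := blowOne 1 S₁ with hT₁
  set ψ₀ := prepPsi S₀ S₁ with hψ₀def
  obtain ⟨hψ₀0, hÂpos, hÂWP, -⟩ := prep_Slab hT1 A hA hex m
  have hψ₀ord : (1 : ℕ∞) ≤ ψ₀.order :=
    MvPowerSeries.one_le_order_iff_constCoeff_eq_zero.mpr hψ₀0 |> fun h => by simpa using h
  have hÂ₀ : (Ahat A hex m).1 = S₀ + S₁ * ψ₀ + ψ₀ ^ 2 := rfl
  have hÂ₁ : (Ahat A hex m).2 = S₁ := recentre_snd_eq _ _ _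
  set χ₀ := blowOne 1 ψ₀ with hχ₀
  have hX₀ : blowOne 2 (Ahat A hex m).1 = T₀ + T₁ * χ₀ + χ₀ ^ 2 := by
    rw [hÂ₀, blowOne_recentre _ _ _ hS₀ord hS₁ord hψ₀ord]
  have hX₁ : blowOne 1 (Ahat A hex m).2 = T₁ := by rw [hÂ₁]
  -- Y
  set ψ₁ := prepPsi (Slab A hex (m + 1)).1 (Slab A hex (m + 1)).2 with hψ₁def
  obtain ⟨hψ₁0, hÂ'pos, hÂ'WP, -⟩ := prep_Slab hT1 A hA hex (m + 1)
  set χ₁ := blowOne 1 ψ' + ψ₁ with hχ₁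
  have hY₀ : (Ahat A hex (m + 1)).1 = T₀ + T₁ * χ₁ + χ₁ ^ 2 := by
    show (Slab A hex (m + 1)).1 + (Slab A hex (m + 1)).2 * ψ₁ + ψ₁ ^ 2 = _
    rw [hSsucc₀, hSsucc₁, blowOne_recentre _ _ _ hS₀ord hS₁ord hψ'ord, hχ₁]
    have h2 : (2 : MvPowerSeries (Fin 2) k) = 0 := two_eq_zero
    linear_combination (-(blowOne 1 ψ' * ψ₁)) * h2
  have hY₁ : (Ahat A hex (m + 1)).2 = T₁ := by
    show (Slab A hex (m + 1)).2 + 2 * ψ₁ = _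
    rw [hSsucc₁, two_eq_zero, zero_mul, add_zero]
  -- Y = recentre (χ₀ + χ₁) X
  have hYX : (Ahat A hex (m + 1)).1 = blowOne 2 (Ahat A hex m).1 + blowOne 1 (Ahat A hex m).2 * (χ₀ + χ₁) + (χ₀ + χ₁) ^ 2 := by
    rw [hY₀, hX₀, hX₁]
    have h2 : (2 : MvPowerSeries (Fin 2) k) = 0 := two_eq_zero
    linear_combination (-(T₁ * χ₀) - χ₀ * χ₁ - χ₀ ^ 2) * h2
  -- X is WP with non-empty Newton set = psi-image
  obtain ⟨hÂWP', hÂpos', hÂne, -⟩ := Ahat_spec hT1 A hA hex m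
  have hsum := two_le_sum_of_isPosition hÂpos'
  have hNX : newtonSet (blowOne 2 (Ahat A hex m).1) (blowOne 1 (Ahat A hex m).2) = psi 2 '' newtonSet (Ahat A hex m).1 (Ahat A hex m).2 :=
    newtonSet_blowOne _ _ hsum
  have hXWP : WellPrepared (blowOne 2 (Ahat A hex m).1) (blowOne 1 (Ahat A hex m).2) := wellPrepared_blowOne _ _ hsum hÂWP'
  have hXne : (newtonSet (blowOne 2 (Ahat A hex m).1) (blowOne 1 (Ahat A hex m).2)).Nonempty := by
    rw [hNX]; exact hÂne.image _
  obtain ⟨-, -, hYne, -⟩ := Ahat_spec hT1 A hA hex (m + 1)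
  have hYWP' : WellPrepared (blowOne 2 (Ahat A hex m).1 + blowOne 1 (Ahat A hex m).2 * (χ₀ + χ₁) + (χ₀ + χ₁) ^ 2)
      (blowOne 1 (Ahat A hex m).2) := by
    rw [← hYX, hX₁, ← hY₁]; exact hÂ'WP
  have hYne' : (newtonSet (blowOne 2 (Ahat A hex m).1 + blowOne 1 (Ahat A hex m).2 * (χ₀ + χ₁) + (χ₀ + χ₁) ^ 2)
      (blowOne 1 (Ahat A hex m).2)).Nonempty := by
    rw [← hYX, hX₁, ← hY₁]; exact hYne
  obtain ⟨hε, hζ⟩ := epsL_zetaL_eq_of_wellPrepared hXWP hYWP' hXne hYne'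
  rw [← hYX] at hε hζ
  have hY₁' : (Ahat A hex (m + 1)).2 = blowOne 1 (Ahat A hex m).2 := by rw [hY₁, hX₁]
  rw [hY₁', hε, hζ, hNX, epsL_image_psi, zetaL_image_psi hsum hÂne]
  exact ⟨rfl, rfl⟩

end Tail

end MonicDescent

end Summit.ResolutionOfSingularities.ResolutionOfSingularities.Theorems

end
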